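import Literature.AlgebraicGeometry.Frobenioids.PerfectionPullbackClasses
import Literature.AlgebraicGeometry.Frobenioids.PerfectionFrobeniusArrows
import Literature.AlgebraicGeometry.Frobenioids.PerfectionDivisorial
import Literature.AlgebraicGeometry.Frobenioids.PreFrobenioidDataToFunctor
import HarnessLib

/-!
# Frobenioids I, Proposition 3.2 (iii) "`C^pf` is a Frobenioid": Definition 1.3 (iv) for the perfection —
# the factorization pull-back ∘ pre-step ∘ Frobenius-type (existence) and (iv)(b) (PROOFS)

Mochizuki, *The geometry of Frobenioids I: the general theory*, Kyushu J. Math. **62** (2008)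
293–400, Definition 1.3 (iv) p. 24, Proposition 3.2 (iii) p. 59 [cite: MochizukiFrdI2008, Prop. 3.2 (iii) p.59].

PROOF-ONLY piece of the row «`C^pf` is a Frobenioid» (row `FrdI:Prop3.2(iii)-frobenioid`, carve-up v2,
L1-lead R99 (2): Def. 1.3 (iv)/(vi) for `Perfection.ops hF`, seat abc-iut-w5-d246), for `C` of
Frobenius-isotropic type (`hiso`, print's standing hypothesis of §3):

* `iv_a_exists_perfection`: every arrow `φ = [ρ] : (A, n) → (B, m)` of `C^pf` factors as
  `γ′ ≫ β′ ≫ α′` with `γ′` of Frobenius type, `β′` a pre-step, `α′` a pull-back morphism — the classes, at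
  the objects `(X₁, n·a)`, `(Y₁, n·a)`, of the factorization `ρ = γ ≫ β ≫ α` of the representative in `C`
  (Def. 1.3 (iv)(a) of `C`), conjugated by the degree-one arrows `X₁ → X₁^{(1)}`, `Y₁ → Y₁^{(1)}`
  (`isPullbackMorphism_mk_of`, `isFrobeniusType_mk_of`);
* `iv_b_perfection`: a pull-back morphism of `C^pf` is LB-invertible and linear — in the factorization
  above `α′` is a pull-back morphism of `C^pf`, so by two-out-of-three (`IsPullbackMorphism.of_comp`) the
  base-isomorphism `γ′ ≫ β′` is a pull-back morphism, hence an isomorphism (Remark 1.2.1), and `α′` is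
  linear and isometric (Def. 1.3 (iv)(b) of `C`).
The uniqueness clause (iv)(a) and (vi) are the sequel files.  No new definitions; nothing here is specific
to the abc programme.
-/

namespace Literature.AlgebraicGeometry.Frobenioids

namespace PreFrobenioid

namespace Perfection

open CategoryTheory Opposite

universe w v v' u u'

variable {D : Type u} [Category.{v} D] {Φ : Dᵒᵖ ⥤ CommMonCat.{w}}
  {C : Type u'} [Category.{v'} C] {F : C ⥤ ElemFrobenioid Φ} {hF : IsFrobenioid F}

/-! ### Isomorphisms of `C^pf` are isometries -/

/-- An isomorphism of `C^pf` has trivial perfected zero divisor (`Φ^pf` is sharp, Remark 1.1.1).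
[cite: MochizukiFrdI2008, Rem. 1.1.1 p.21] -/
theorem div_eq_one_of_isIso {X Y : Perfection hF} (e : X ⟶ Y) [IsIso e] : (ops hF).div e = 1 :=
  (Frobenioids.Perfection.isSharp (hF.isPreFrobenioid.isDivisorial (baseObj F X.obj)).isSharp).eq_one_of_isUnit _
    (isUnit_div_of_isIso (ops hF).toFunctor e)

/-- A pull-back morphism of `C^pf` that is a base-isomorphism is an isomorphism (Remark 1.2.1 for the
structure functor `(Perfection.ops hF).toFunctor`). [cite: MochizukiFrdI2008, Rem. 1.2.1 p.22] -/
theorem isIso_of_isPullbackMorphism_of_isBaseIso {X Y : Perfection hF} (f : X ⟶ Y)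
    (h : (ops hF).IsPullbackMorphism f) (hb : (ops hF).IsBaseIso f) : IsIso f :=
  (isPullbackMorphism_and_isBaseIso_iff_isIso (ops hF).toFunctor f).mp
    ⟨(PreFrobenioidData.ofFunctor_isPullbackMorphism (ops hF).toFunctor f).mp h, hb⟩

/-! ### The three classes of a factorization in `C` -/

section Pieces

variable {X Y : Perfection hF} {a b : ℕ+} (hab : X.idx * a = Y.idx * b) {X₁ Y₁ : C}
  (γ : frobPow hF X.obj a ⟶ X₁) (β₀ : X₁ ⟶ Y₁) (α : Y₁ ⟶ frobPow hF Y.obj b)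

/-- The level condition of the first piece `(A, n) → (X₁, n·a)`. [cite: MochizukiFrdI2008, Def. 3.1 (iii) p.57] -/
theorem lev₁ : X.idx * a = (⟨X₁, X.idx * a⟩ : Perfection hF).idx * 1 := (mul_one _).symm

/-- The level condition of the middle piece `(X₁, n·a) → (Y₁, n·a)`. [cite: MochizukiFrdI2008, Def. 3.1 (iii) p.57] -/
theorem lev₂ : (⟨X₁, X.idx * a⟩ : Perfection hF).idx * 1 = (⟨Y₁, X.idx * a⟩ : Perfection hF).idx * 1 := rfl

include hab in
/-- The level condition of the last piece `(Y₁, n·a) → (B, m)`. [cite: MochizukiFrdI2008, Def. 3.1 (iii) p.57] -/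
theorem lev₃ : (⟨Y₁, X.idx * a⟩ : Perfection hF).idx * 1 = Y.idx * b := (mul_one _).trans hab

/-- The composite of the three classes is the class of `γ ≫ β₀ ≫ α`. [cite: MochizukiFrdI2008, Def. 3.1 (iii) p.57] -/
theorem pieces_comp :
    haveI := isIso_frob_one (hF := hF) X₁
    haveI := isIso_frob_one (hF := hF) Y₁
    (Hom.mk (⟨⟨a, 1, lev₁⟩, γ ≫ frob hF X₁ 1⟩ : Rep X ⟨X₁, X.idx * a⟩) ≫
        Hom.mk (⟨⟨1, 1, lev₂⟩, inv (frob hF X₁ 1) ≫ β₀ ≫ frob hF Y₁ 1⟩ : Rep ⟨X₁, X.idx * a⟩ ⟨Y₁, X.idx * a⟩) ≫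
          Hom.mk (⟨⟨1, b, lev₃ hab⟩, inv (frob hF Y₁ 1) ≫ α⟩ : Rep ⟨Y₁, X.idx * a⟩ Y) : X ⟶ Y) =
      Hom.mk ⟨⟨a, b, hab⟩, γ ≫ β₀ ≫ α⟩ := by
  haveI := isIso_frob_one (hF := hF) X₁
  haveI := isIso_frob_one (hF := hF) Y₁
  rw [mk_comp_mk_aligned, mk_comp_mk_aligned]
  simp only [Category.assoc, IsIso.hom_inv_id_assoc]

end Pieces

/-! ### Definition 1.3 (iv)(a), existence -/

/-- **Def. 1.3 (iv)(a) for `C^pf`, existence**: every arrow of `C^pf` factors as (Frobenius type) ≫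
(pre-step) ≫ (pull-back morphism). [cite: MochizukiFrdI2008, Prop. 3.2 (iii) p.59] -/
theorem iv_a_exists_perfection ⦃X Y : Perfection hF⦄ (φ : X ⟶ Y) :
    ∃ (P Q : Perfection hF) (γ' : X ⟶ P) (β' : P ⟶ Q) (α' : Q ⟶ Y), γ' ≫ β' ≫ α' = φ ∧
      (ops hF).IsFrobeniusType γ' ∧ (ops hF).IsPreStep β' ∧ (ops hF).IsPullbackMorphism α' := by
  obtain ⟨⟨⟨a, b, hab⟩, ρ⟩, rfl⟩ := Hom.mk_surjective φ
  change X.idx * a = Y.idx * b at hab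
  change (frobPow hF X.obj a ⟶ frobPow hF Y.obj b) at ρ
  obtain ⟨X₁, Y₁, γ, β₀, α, hfac, hγ, hβ₀, hα⟩ := hF.iv_a_exists ρ
  haveI := isIso_frob_one (hF := hF) X₁
  haveI := isIso_frob_one (hF := hF) Y₁
  refine ⟨⟨X₁, X.idx * a⟩, ⟨Y₁, X.idx * a⟩, Hom.mk ⟨⟨a, 1, lev₁⟩, γ ≫ frob hF X₁ 1⟩,
    Hom.mk ⟨⟨1, 1, lev₂⟩, inv (frob hF X₁ 1) ≫ β₀ ≫ frob hF Y₁ 1⟩,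
    Hom.mk ⟨⟨1, b, lev₃ hab⟩, inv (frob hF Y₁ 1) ≫ α⟩, ?_, ?_, ?_, ?_⟩
  · rw [pieces_comp hab γ β₀ α, hfac]
  · exact isFrobeniusType_mk_of _ (IsFrobeniusType.comp F hF hγ (isFrobeniusType_frob hF X₁ 1))
  · exact (isPreStep_mk_iff (⟨⟨1, 1, lev₂⟩, _⟩ : Rep (⟨X₁, X.idx * a⟩ : Perfection hF) ⟨Y₁, X.idx * a⟩)).mpr
      (IsPreStep.comp F (PreFrobenioid.isPreStep_of_isIso F _)
        (IsPreStep.comp F hβ₀ (PreFrobenioid.isPreStep_of_isIso F _)))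
  · exact isPullbackMorphism_mk_of 1 b (lev₃ hab) _
      (IsPullbackMorphism.comp F (isPullbackMorphism_of_isIso F _) hα)

/-! ### Definition 1.3 (iv)(b) -/

/-- **Def. 1.3 (iv)(b) for `C^pf`** (for `C` of Frobenius-isotropic type): a pull-back morphism of `C^pf` is
LB-invertible and linear. [cite: MochizukiFrdI2008, Prop. 3.2 (iii) p.59] -/
theorem iv_b_perfection (hiso : IsOfType (IsFrobeniusIsotropic F)) ⦃X Y : Perfection hF⦄ (φ : X ⟶ Y)
    (hφ : (ops hF).IsPullbackMorphism φ) : (ops hF).IsLBInvertible φ ∧ (ops hF).IsLinear φ := by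
  obtain ⟨⟨⟨a, b, hab⟩, ρ⟩, rfl⟩ := Hom.mk_surjective φ
  change X.idx * a = Y.idx * b at hab
  change (frobPow hF X.obj a ⟶ frobPow hF Y.obj b) at ρ
  obtain ⟨X₁, Y₁, γ, β₀, α, hfac, hγ, hβ₀, hα⟩ := hF.iv_a_exists ρ
  haveI := isIso_frob_one (hF := hF) X₁
  haveI := isIso_frob_one (hF := hF) Y₁
  obtain ⟨⟨-, hαiso⟩, hαlin⟩ := hF.iv_b α hα
  -- the two pieces `f₁ = [γ ≫ β₀ ≫ frob]`, `f₂ = [frob⁻¹ ≫ α]` with `f₁ ≫ f₂ = [ρ]`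
  let P : Perfection hF := ⟨Y₁, X.idx * a⟩
  have hl₁ : X.idx * a = P.idx * 1 := (mul_one _).symm
  let f₁ : X ⟶ P := Hom.mk ⟨⟨a, 1, hl₁⟩, (γ ≫ β₀) ≫ frob hF Y₁ 1⟩
  let f₂ : P ⟶ Y := Hom.mk ⟨⟨1, b, lev₃ hab⟩, inv (frob hF Y₁ 1) ≫ α⟩
  have hcomp : f₁ ≫ f₂ = Hom.mk ⟨⟨a, b, hab⟩, ρ⟩ := by
    change (Hom.mk (⟨⟨a, 1, hl₁⟩, (γ ≫ β₀) ≫ frob hF Y₁ 1⟩ : Rep X P) ≫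
      Hom.mk (⟨⟨1, b, lev₃ hab⟩, inv (frob hF Y₁ 1) ≫ α⟩ : Rep P Y) : X ⟶ Y) = _
    rw [mk_comp_mk_aligned, ← hfac]
    simp only [Category.assoc, IsIso.hom_inv_id_assoc]
  have hf₂ : (ops hF).IsPullbackMorphism f₂ :=
    isPullbackMorphism_mk_of 1 b (lev₃ hab) _ (IsPullbackMorphism.comp F (isPullbackMorphism_of_isIso F _) hα)
  -- `f₁` is a pull-back morphism (two-out-of-three) and a base-isomorphism, hence an isomorphism
  have hf₁ : (ops hF).IsPullbackMorphism f₁ :=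
    PreFrobenioidData.IsPullbackMorphism.of_comp hf₂ (by rw [hcomp]; exact hφ)
  have hf₁b : (ops hF).IsBaseIso f₁ :=
    (isBaseIso_mk_iff (⟨⟨a, 1, hl₁⟩, _⟩ : Rep X P)).mpr
      (IsBaseIso.comp F (IsBaseIso.comp F hγ.2 hβ₀.2) (isFrobeniusType_frob hF Y₁ 1).2)
  haveI : IsIso f₁ := isIso_of_isPullbackMorphism_of_isBaseIso f₁ hf₁ hf₁b
  -- degree and divisor of `f₂`
  have hdeg₂ : (ops hF).degFr f₂ = 1 := by
    change PreFrobenioid.degFr F (inv (frob hF Y₁ 1) ≫ α) = 1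
    rw [degFr_comp, show PreFrobenioid.degFr F α = 1 from hαlin, mul_one]
    exact isLinear_of_isIso F _
  have hdiv₂ : (ops hF).div f₂ = 1 := by
    change Frobenioids.Perfection.mk (pull Φ (Base F (frob hF Y₁ 1)) (Div F (inv (frob hF Y₁ 1) ≫ α))) (P.idx * 1) = 1
    rw [div_comp, show Div F α = 1 from hαiso, map_one, one_mul,
      show Div F (inv (frob hF Y₁ 1)) = 1 from isIsometry_of_isIso F hF.isPreFrobenioid _, one_pow, map_one,
      Frobenioids.Perfection.mk_one]
  rw [← hcomp]
  refine ⟨⟨isCoAngular_of_frobeniusIsotropic hiso _, ?_⟩, ?_⟩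
  · change (ops hF).div (f₁ ≫ f₂) = 1
    rw [(ops hF).div_comp, hdiv₂, map_one, one_mul, div_eq_one_of_isIso, one_pow]
  · change (ops hF).degFr (f₁ ≫ f₂) = 1
    rw [(ops hF).degFr_comp, hdeg₂, mul_one, degFr_eq_one_of_isIso]

end Perfection

end PreFrobenioid

end Literature.AlgebraicGeometry.Frobenioids
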